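import Literature.Probability.Percolation.QuadCrossingContinuityCaseThreeTame
import Literature.Probability.Percolation.QuadCrossingContinuityCaseTwoTameAll
import Literature.Probability.Percolation.QuadCrossingContinuityCaseThreeSmall
import Literature.Probability.Percolation.QuadCrossingContinuityCaseThreeSmallOne
import HarnessLib

/-!
# Schramm–Smirnov Lemma 6.1, case (3), tame pairs, all sub-cases

Topic `Probability/Percolation`; proofs file towards the named fact `SchrammSmirnov2011_lemma_6_1`
(`QuadCrossingContinuity.lean`; O. Schramm, S. Smirnov, *On the scaling limits of planar
percolation*, Ann. Probab. 39 (2011), arXiv:1101.5820, Lemma 6.1 (3) and its proof, p. 23: "the proof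
in case (3) is symmetric to that of case (2)", sub-cases (i) `d ≤ 4δ`, (ii), (iii)).

The mirror image of `QuadCrossingContinuityCaseTwoTameAll.lean` with the roles of `d₀` and `d₁`
exchanged: combine the thin regimes of case (3), proved for all quads
(`…_of_isPerturbationThree_of_sideDist_zero_le`, `…_of_isPerturbationThree_of_sideDist_one_le`),
with the product-form theorem of the dual exploration for the main regime
(`measureReal_symmDiff_le_mul_of_isPerturbationThree_of_tame`, tame pairs with a cut `ζ`), the factor
`P(dual crossing of rot Q')` being dropped (`≤ 1`) when `d₁(Q) ≤ C d₀(Q)` and bounded a priori by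
`(C d₀/d₁)^α` otherwise (a dual crossing of `Q'` from `∂₁Q'` to `∂₃Q'` crosses a closed annulus about
the foot of a short `∂₀Q–∂₂Q` transversal, `Quad.mem_annulusDualCrossing_of_path_avoiding_inner`, RSW):
`μ_η(⊞_Q Δ ⊞_{Q'}) ≤ 2 (C K ρ / d(Q))^α` in the regime `K ρ ≤ c d(Q)`
(`real_symmDiff_crossedEvent_le_of_isPerturbationThree_of_tame_all`).  Everything is proved; no named
fact is introduced.

## References

* O. Schramm, S. Smirnov, Ann. Probab. 39 (2011) 1768–1814, arXiv:1101.5820, Lemma 6.1 and its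
  proof. [SchrammSmirnov2011]
-/

noncomputable section

open Set Metric Filter Function
open _root_.MeasureTheory _root_.Topology
open scoped ENNReal symmDiff
open Literature.Probability.LatticeModels
open Literature.Topology.PlaneTopology

namespace Literature.Probability.Percolation

namespace QuadCrossing

variable {D : Set ℂ}

/-- Condition (3) passes to larger scales. [folklore] -/
theorem Quad.IsPerturbationThree.mono {Q Q' : Quad D} {δ δ' : ℝ} (h : Q.IsPerturbationThree Q' δ)
    (hδ : δ ≤ δ') : Q.IsPerturbationThree Q' δ' := by
  obtain ⟨hcar, h0, h1, h2, hjoin⟩ := h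
  refine ⟨hcar, h0, h1, h2, fun x hx => ?_⟩
  obtain ⟨y, hy, α, hα, hαd⟩ := hjoin x hx
  exact ⟨y, hy, α, hα, hαd.trans hδ⟩
set_option maxHeartbeats 400000 in
/-- **Schramm–Smirnov Lemma 6.1, case (3), tame pairs, all sub-cases** (see the module docstring).
[cite: SchrammSmirnov2011, Lemma 6.1 (3) and its proof, (i)–(iii)] -/
theorem real_symmDiff_crossedEvent_le_of_isPerturbationThree_of_tame_all :
    ∃ α C c : ℝ, 0 < α ∧ 0 < C ∧ 0 < c ∧
      ∀ (D : Set ℂ) (Q Q' : Quad D) (ρ K : ℝ), 0 < ρ → 1 ≤ K → K * ρ ≤ c * Q.sizeParam →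
        Q.IsPerturbationThree Q' ρ →
        (∀ η : ℝ, 0 < η → η < ρ → ∀ a b : Site 2, (zdGraph 2).Adj a b →
          IsPreconnected (segment ℝ (meshPoint (η * Real.sqrt 2) a) (meshPoint (η * Real.sqrt 2) b) ∩
            Q.carrier)) →
        (∀ η : ℝ, 0 < η → η < ρ → ∀ p : Site 2 × Site 2, (zdGraph 2).Adj p.1 p.2 →
          IsPreconnected (Q'.piece (η * Real.sqrt 2) p)) →
        (∀ s t : unitInterval, dist (Q'.rot (1, s)) (Q'.rot (1, t)) ≤ ρ → ∀ u : unitInterval,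
          ((s : ℝ) ≤ u ∧ (u : ℝ) ≤ t ∨ (t : ℝ) ≤ u ∧ (u : ℝ) ≤ s) →
            dist (Q'.rot (1, u)) (Q'.rot (1, s)) ≤ K * ρ) →
        (∃ ζ : ℝ, (∀ t : unitInterval, (t : ℝ) ≤ ζ → ∀ y ∈ Q.side 0, ∀ p : Path (Q'.rot (1, t)) y,
            range p ⊆ Q.carrier → Q.sideDist 0 / 4 ≤ Metric.diam (range p)) ∧
          (∀ t : unitInterval, ζ ≤ (t : ℝ) → ∀ y ∈ Q.side 2, ∀ p : Path (Q'.rot (1, t)) y,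
            range p ⊆ Q.carrier → Q.sideDist 0 / 4 ≤ Metric.diam (range p))) →
        ∀ η : ℝ, 0 < η → η < ρ →
          (squareCrossingLaw D η : Measure (QuadConfig D)).real
              (symmDiff (QuadConfig.crossedEvent Q) (QuadConfig.crossedEvent Q')) ≤
            2 * ((C * K * ρ) / Q.sizeParam) ^ α := by
  -- the four ingredients
  obtain ⟨α₁, C₁, c₁, hα₁, hC₁, hc₁, hT⟩ := measureReal_symmDiff_le_mul_of_isPerturbationThree_of_tame
  obtain ⟨α₂, C₂, c₂, hα₂, hC₂, hc₂, hS⟩ :=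
    real_symmDiff_crossedEvent_le_of_isPerturbationThree_of_sideDist_zero_le
  obtain ⟨α₃, C₃, c₃, hα₃, hC₃, hc₃, hZ⟩ :=
    real_symmDiff_crossedEvent_le_of_isPerturbationThree_of_sideDist_one_le
  obtain ⟨α₄, c₀, hα₄, hc₀, hRSW⟩ := annulusDualCrossing_half_le_holds
  -- constants
  set C₆ : ℝ := 7 + 2 * c₀ with hC₆
  have hC₆pos : 0 < C₆ := by rw [hC₆]; linarith
  set C₄ : ℝ := 32 * C₆ with hC₄
  have hC₄pos : 0 < C₄ := by rw [hC₄]; positivity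
  set C₅ : ℝ := 64 * C₆ with hC₅
  have hC₅pos : 0 < C₅ := by rw [hC₅]; positivity
  have hC₄C₅ : C₄ ≤ C₅ := by rw [hC₄, hC₅]; linarith
  -- the threshold constant `c'`
  set c' : ℝ := min (min c₁ c₃) (min C₁⁻¹ 1) with hc'
  have hc'pos : 0 < c' := by rw [hc']; exact lt_min (lt_min hc₁ hc₃) (lt_min (inv_pos.2 hC₁) one_pos)
  have hc'c₁ : c' ≤ c₁ := by rw [hc']; exact (min_le_left _ _).trans (min_le_left _ _)
  have hc'c₃ : c' ≤ c₃ := by rw [hc']; exact (min_le_left _ _).trans (min_le_right _ _)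
  have hc'C₁ : c' ≤ C₁⁻¹ := by rw [hc']; exact (min_le_right _ _).trans (min_le_left _ _)
  have hc'1 : c' ≤ 1 := by rw [hc']; exact (min_le_right _ _).trans (min_le_right _ _)
  have hc'C₁' : C₁ * c' ≤ 1 := by
    have := mul_le_mul_of_nonneg_left hc'C₁ hC₁.le
    rwa [mul_inv_cancel₀ hC₁.ne'] at this
  -- the exponent and the constant of the conclusion
  set α : ℝ := min (min α₁ α₂) (min α₃ α₄) with hαdef
  have hαpos : 0 < α := by rw [hαdef]; exact lt_min (lt_min hα₁ hα₂) (lt_min hα₃ hα₄)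
  have hαα₁ : α ≤ α₁ := by rw [hαdef]; exact (min_le_left _ _).trans (min_le_left _ _)
  have hαα₂ : α ≤ α₂ := by rw [hαdef]; exact (min_le_left _ _).trans (min_le_right _ _)
  have hαα₃ : α ≤ α₃ := by rw [hαdef]; exact (min_le_right _ _).trans (min_le_left _ _)
  have hαα₄ : α ≤ α₄ := by rw [hαdef]; exact (min_le_right _ _).trans (min_le_right _ _)
  set Cf : ℝ := max (max (C₂ / c') C₃) (C₁ * C₅) with hCf
  have hCf₂ : C₂ / c' ≤ Cf := by rw [hCf]; exact (le_max_left _ _).trans (le_max_left _ _)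
  have hCf₃ : C₃ ≤ Cf := by rw [hCf]; exact (le_max_right _ _).trans (le_max_left _ _)
  have hCf₅ : C₁ * C₅ ≤ Cf := by rw [hCf]; exact le_max_right _ _
  have hCfpos : 0 < Cf := lt_of_lt_of_le (div_pos hC₂ hc'pos) hCf₂
  -- the regime constant `c`
  set c : ℝ := min (min (c' * c₂) (c' / C₂)) (min (min (1 / C₃) (1 / (C₁ * C₅))) (min (1 / 64) (c' / 2)))
    with hcdef
  have hcpos : 0 < c := by
    rw [hcdef]
    refine lt_min (lt_min (mul_pos hc'pos hc₂) (div_pos hc'pos hC₂))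
      (lt_min (lt_min ?_ ?_) (lt_min ?_ ?_))
    · positivity
    · positivity
    · norm_num
    · positivity
  have hc_1 : c ≤ c' * c₂ := by rw [hcdef]; exact (min_le_left _ _).trans (min_le_left _ _)
  have hc_2 : c ≤ c' / C₂ := by rw [hcdef]; exact (min_le_left _ _).trans (min_le_right _ _)
  have hc_3 : c ≤ 1 / C₃ := by
    rw [hcdef]; exact (min_le_right _ _).trans ((min_le_left _ _).trans (min_le_left _ _))
  have hc_4 : c ≤ 1 / (C₁ * C₅) := by
    rw [hcdef]; exact (min_le_right _ _).trans ((min_le_left _ _).trans (min_le_right _ _))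
  have hc_5 : c ≤ 1 / 64 := by
    rw [hcdef]; exact (min_le_right _ _).trans ((min_le_right _ _).trans (min_le_left _ _))
  have hc_6 : c ≤ c' / 2 := by
    rw [hcdef]; exact (min_le_right _ _).trans ((min_le_right _ _).trans (min_le_right _ _))
  refine ⟨α, Cf, c, hαpos, hCfpos, hcpos, ?_⟩
  intro D Q Q' ρ K hρ hK hρc h2 htame htame' harc hcut η hη hηρ
  have hd₁pos' : 0 < Q.sideDist 1 := Q.sideDist_pos 1
  have hd₀pos' : 0 < Q.sideDist 0 := Q.sideDist_pos 0
  have hdpos : 0 < Q.sizeParam := Q.sizeParam_pos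
  have hdmax : Q.sizeParam = max (Q.sideDist 1) (Q.sideDist 0) := max_comm _ _
  have hKpos : 0 < K := by linarith
  have hKρpos : 0 < K * ρ := mul_pos hKpos hρ
  have hρKρ : ρ ≤ K * ρ := le_mul_of_one_le_left hρ.le hK
  -- Case A: `d₁ ≤ K ρ / c'` — sub-case (ii) at scale `K ρ / c'`
  have hρ₂pos : 0 < K * ρ / c' := div_pos hKρpos hc'pos
  have hρρ₂ : ρ ≤ K * ρ / c' := by
    rw [le_div_iff₀ hc'pos]
    calc ρ * c' ≤ ρ * 1 := by gcongr
      _ ≤ K * ρ := by linarith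
  have hcc' : c < c' := by linarith
  by_cases hA : Q.sideDist 0 ≤ K * ρ / c'
  · -- here `d = d₀`
    have hlt : Q.sideDist 0 < Q.sizeParam := by
      have h1 : Q.sideDist 0 * c' ≤ K * ρ := (le_div_iff₀ hc'pos).1 hA
      have h2 : c * Q.sizeParam < c' * Q.sizeParam := mul_lt_mul_of_pos_right hcc' hdpos
      nlinarith
    have hdd₀ : Q.sizeParam = Q.sideDist 1 := by
      rw [hdmax] at hlt ⊢
      rcases le_total (Q.sideDist 1) (Q.sideDist 0) with h | h
      · rw [max_eq_right h] at hlt; exact absurd hlt (lt_irrefl _)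
      · exact max_eq_left h
    have hρ₂c : K * ρ / c' ≤ c₂ * Q.sideDist 1 := by
      rw [← hdd₀, div_le_iff₀ hc'pos]
      calc K * ρ ≤ c * Q.sizeParam := hρc
        _ ≤ (c' * c₂) * Q.sizeParam := by gcongr
        _ = c₂ * Q.sizeParam * c' := by ring
    have hmain := hS D Q Q' (K * ρ / c') hρ₂pos hρ₂c (Quad.IsPerturbationThree.mono h2 hρρ₂) hA η hη (hηρ.trans_le hρρ₂)
    refine hmain.trans ?_
    rw [← hdd₀]
    obtain ⟨hx0, hx1, hxle⟩ := tame_all_arith_A hC₂ hc'pos hdpos hKρpos hρc hc_2 hCf₂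
    exact rpow_le_two_mul_rpow hx0 hx1 hαpos hαα₂ hxle
  -- Case B: `d₁ > K ρ / c'`, i.e. `K ρ < c' d₁`
  push Not at hA
  have hKρd₁ : K * ρ < c' * Q.sideDist 0 := by
    have := (div_lt_iff₀ hc'pos).1 hA; linarith
  have hρd₁ : ρ < Q.sideDist 0 := by
    have : c' * Q.sideDist 0 ≤ 1 * Q.sideDist 0 := mul_le_mul_of_nonneg_right hc'1 hd₀pos'.le
    linarith
  by_cases hB1 : Q.sideDist 1 ≤ ρ
  · -- Case B1: `d₀ ≤ ρ` — the fixed-centre closed arm; here `d = d₁`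
    have hdd₁ : Q.sizeParam = Q.sideDist 0 := by
      rw [hdmax]; exact max_eq_right (by linarith)
    have hρc₃ : ρ ≤ c₃ * Q.sideDist 0 := by
      have : c' * Q.sideDist 0 ≤ c₃ * Q.sideDist 0 := mul_le_mul_of_nonneg_right hc'c₃ hd₀pos'.le
      linarith
    have hmain := hZ D Q Q' ρ hρ hρc₃ h2 hB1 η hη hηρ
    refine hmain.trans ?_
    rw [← hdd₁]
    have hρc' : K * ρ ≤ c * Q.sizeParam := hρc
    obtain ⟨hx0, hx1, hxle⟩ := tame_all_arith_B1 hC₃ hdpos hρ hK hρc' hc_3 hCf₃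
    exact rpow_le_two_mul_rpow hx0 hx1 hαpos hαα₃ hxle
  -- Case B2: `ρ < d₀` — the lowest-crossing theorem, product form
  push Not at hB1
  have hKρc₁ : K * ρ ≤ c₁ * Q.sideDist 0 := by
    have : c' * Q.sideDist 0 ≤ c₁ * Q.sideDist 0 := mul_le_mul_of_nonneg_right hc'c₁ hd₀pos'.le
    linarith
  have hprod := hT D Q Q' ρ K hρ hK hKρc₁ hB1 h2 htame htame' harc hcut η hη hηρ
  refine (real_squareCrossingLaw_symmDiff_le D η Q Q').trans (hprod.trans ?_)
  set μ := bondPercolation (zdGraph 2) half with hμ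
  set B : Set (BondConfig (Site 2)) := {ω | ∃ β : ℝ → ℂ, ContinuousOn β (Icc 0 1) ∧
      MapsTo β (Icc 0 1) Q'.carrier ∧ β 0 ∈ Q'.side 1 ∧ β 1 ∈ Q'.side 3 ∧
      ∀ t ∈ Icc (0 : ℝ) 1, β t ∉ openEdgeUnion (η * Real.sqrt 2) ω} with hB
  have hB0 : 0 ≤ μ.real B := measureReal_nonneg
  have hB1' : μ.real B ≤ 1 := measureReal_le_one
  obtain ⟨hy0, hy1⟩ := tame_all_arith_B2 hC₁ hd₀pos' hKρpos hKρd₁ hc'C₁'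
  by_cases hB2 : Q.sideDist 1 ≤ C₅ * Q.sideDist 0
  · -- Case B2a: `d₀ ≤ C₅ d₁`, hence `d ≤ C₅ d₁`; drop the factor `P(⊞_{Q'}) ≤ 1`
    have hd₁C₅ : Q.sideDist 0 ≤ C₅ * Q.sideDist 0 := by
      have : 1 * Q.sideDist 0 ≤ C₅ * Q.sideDist 0 :=
        mul_le_mul_of_nonneg_right (by rw [hC₅]; linarith) hd₀pos'.le
      linarith
    have hdC₅ : Q.sizeParam ≤ C₅ * Q.sideDist 0 := by rw [hdmax]; exact max_le hB2 hd₁C₅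
    have hxle : C₁ * K * ρ / Q.sideDist 0 ≤ Cf * K * ρ / Q.sizeParam := by
      rw [div_le_div_iff₀ hd₀pos' hdpos]
      calc C₁ * K * ρ * Q.sizeParam ≤ C₁ * K * ρ * (C₅ * Q.sideDist 0) := by gcongr
        _ = (C₁ * C₅) * K * ρ * Q.sideDist 0 := by ring
        _ ≤ Cf * K * ρ * Q.sideDist 0 := by gcongr
    exact two_mul_rpow_mul_le hy0 hy1 hB1' hαpos hαα₁ hxle
  -- Case B2b: `d₀ > C₅ d₁` — multiply by the a-priori bound `P(⊞_{Q'}) ≤ (C₄ d₁ / d₀)^α₄`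
  push Not at hB2
  have hC₆d : 64 * (C₆ * Q.sideDist 0) < Q.sideDist 1 := by
    have : C₅ * Q.sideDist 0 = 64 * (C₆ * Q.sideDist 0) := by rw [hC₅]; ring
    linarith
  have hC₆d₁ : 5 * Q.sideDist 0 ≤ C₆ * Q.sideDist 0 :=
    mul_le_mul_of_nonneg_right (by rw [hC₆]; linarith) hd₀pos'.le
  have hd₁d₀ : 320 * Q.sideDist 0 < Q.sideDist 1 := by linarith
  have hdd₀ : Q.sizeParam = Q.sideDist 1 := by
    rw [hdmax]; exact max_eq_left (by linarith)
  -- the mesh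
  have hδ'pos : 0 < η * Real.sqrt 2 := mul_pos hη (Real.sqrt_pos.2 (by norm_num))
  have hsqrt2 : Real.sqrt 2 < 2 := by
    rw [show (2 : ℝ) = Real.sqrt 4 by rw [show (4 : ℝ) = 2 ^ 2 by norm_num, Real.sqrt_sq (by norm_num)]]
    exact Real.sqrt_lt_sqrt (by norm_num) (by norm_num)
  have hδ'ρ : η * Real.sqrt 2 < 2 * ρ := by
    calc η * Real.sqrt 2 < ρ * 2 := mul_lt_mul'' hηρ hsqrt2 hη.le (Real.sqrt_nonneg _)
      _ = 2 * ρ := by ring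
  have hρd₀ : 64 * ρ ≤ Q.sideDist 1 := by
    have hh : K * ρ ≤ c * Q.sideDist 1 := by rw [← hdd₀]; exact hρc
    have hc64 : c * Q.sideDist 1 ≤ (1 / 64) * Q.sideDist 1 :=
      mul_le_mul_of_nonneg_right hc_5 hd₁pos'.le
    linarith
  -- the a-priori bound: a dual crossing of `Q'` from `∂₁Q'` to `∂₃Q'` crosses a closed annulus about
  -- the foot of a short `∂₀Q–∂₂Q` transversal
  obtain ⟨hcar, h0, h1, h2s, hjoin⟩ := h2
  obtain ⟨x₀, hx₀, x₂, hx₂, τ, hτ, hτdiam⟩ := Q.exists_transversal_zero_diam_lt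
  have hD₁ : Metric.diam (range τ) ≤ 2 * Q.sideDist 0 := hτdiam.le
  have hR2 : 2 * (Q.sideDist 1 / 16) < Q.sideDist 1 - ρ := by linarith
  have hRδ : 2 * Q.sideDist 0 + ρ + 2 * (η * Real.sqrt 2) ≤ Q.sideDist 1 / 16 := by linarith
  set r₄ : ℝ := max (2 * Q.sideDist 0 + ρ + 2 * (η * Real.sqrt 2)) (c₀ * (η * Real.sqrt 2)) with hr₄
  have hBE : B ⊆ annulusDualCrossing x₀ (η * Real.sqrt 2) r₄ (Q.sideDist 1 / 16 - 2 * (η * Real.sqrt 2)) :=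
      fun ω hω => by
    obtain ⟨β, hβc, hβQ', hβ0, hβ1, hβO⟩ := hω
    exact annulusDualCrossing_mono_left x₀ _ (le_max_left _ _) _
      (Quad.mem_annulusDualCrossing_of_path_avoiding_inner hδ'pos hρ.le hcar h1.le hjoin hx₀ hx₂ τ hτ
        hD₁ hR2 hRδ hβc hβQ' hβ0 hβ1 hβO)
  have hr₄δ : c₀ * (η * Real.sqrt 2) ≤ r₄ := le_max_right _ _
  have hc₀δ : c₀ * (η * Real.sqrt 2) ≤ c₀ * (2 * Q.sideDist 0) :=
    mul_le_mul_of_nonneg_left (by linarith) hc₀.le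
  have hr₄le : r₄ ≤ C₆ * Q.sideDist 0 := by
    have hC₆eq : C₆ * Q.sideDist 0 = 7 * Q.sideDist 0 + c₀ * (2 * Q.sideDist 0) := by rw [hC₆]; ring
    rw [hr₄, max_le_iff, hC₆eq]
    have hc₀d₁ : 0 ≤ c₀ * (2 * Q.sideDist 0) := by positivity
    constructor
    · linarith
    · linarith
  have hR'ge : Q.sideDist 1 / 32 ≤ Q.sideDist 1 / 16 - 2 * (η * Real.sqrt 2) := by linarith
  have h2r₄ : 2 * r₄ ≤ Q.sideDist 1 / 16 - 2 * (η * Real.sqrt 2) := by linarith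
  have hr₄pos : 0 < r₄ := lt_of_lt_of_le (by positivity) (le_max_right _ _)
  have hapriori : μ.real B ≤ (C₄ * Q.sideDist 0 / Q.sideDist 1) ^ α₄ := by
    have hmono : μ.real B ≤
        μ.real (annulusDualCrossing x₀ (η * Real.sqrt 2) r₄ (Q.sideDist 1 / 16 - 2 * (η * Real.sqrt 2))) :=
      measureReal_mono hBE (measure_ne_top _ _)
    refine hmono.trans ((hRSW x₀ _ r₄ _ hδ'pos hr₄δ h2r₄).trans ?_)
    have hbase : r₄ / (Q.sideDist 1 / 16 - 2 * (η * Real.sqrt 2)) ≤ C₄ * Q.sideDist 0 / Q.sideDist 1 := by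
      rw [div_le_div_iff₀ (by linarith) hd₁pos']
      have h1' : r₄ * Q.sideDist 1 ≤ (C₆ * Q.sideDist 0) * Q.sideDist 1 :=
        mul_le_mul_of_nonneg_right hr₄le hd₁pos'.le
      have h2' : (C₆ * Q.sideDist 0) * (Q.sideDist 1 / 32) ≤
          (C₆ * Q.sideDist 0) * (Q.sideDist 1 / 16 - 2 * (η * Real.sqrt 2)) :=
        mul_le_mul_of_nonneg_left hR'ge (by positivity)
      have h3' : C₄ * Q.sideDist 0 * (Q.sideDist 1 / 16 - 2 * (η * Real.sqrt 2)) =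
          32 * ((C₆ * Q.sideDist 0) * (Q.sideDist 1 / 16 - 2 * (η * Real.sqrt 2))) := by rw [hC₄]; ring
      rw [h3']
      linarith
    exact Real.rpow_le_rpow (div_nonneg hr₄pos.le (by linarith)) hbase hα₄.le
  -- the base of the second factor `≤ 1`, and the product of the two bases
  have hz0 : 0 < C₄ * Q.sideDist 0 / Q.sideDist 1 := by positivity
  have hz1 : C₄ * Q.sideDist 0 / Q.sideDist 1 ≤ 1 := by
    rw [div_le_one hd₁pos']
    have : C₄ * Q.sideDist 0 = 32 * (C₆ * Q.sideDist 0) := by rw [hC₄]; ring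
    linarith
  have hxz : C₁ * K * ρ / Q.sideDist 0 * (C₄ * Q.sideDist 0 / Q.sideDist 1) ≤
      Cf * K * ρ / Q.sizeParam := by
    have heq : C₁ * K * ρ / Q.sideDist 0 * (C₄ * Q.sideDist 0 / Q.sideDist 1) =
        (C₁ * C₄) * K * ρ / Q.sizeParam := by
      rw [hdd₀]; field_simp
    rw [heq]
    apply div_le_div_of_nonneg_right _ hdpos.le
    have hCf : C₁ * C₄ ≤ Cf :=
      calc C₁ * C₄ ≤ C₁ * C₅ := by gcongr
        _ ≤ Cf := hCf₅
    calc C₁ * C₄ * K * ρ = (C₁ * C₄) * (K * ρ) := by ring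
      _ ≤ Cf * (K * ρ) := by gcongr
      _ = Cf * K * ρ := by ring
  exact two_mul_rpow_mul_le_of_le_rpow hy0 hy1 hz0 hz1 hB0 hapriori hαpos hαα₁ hαα₄ hxz


end QuadCrossing

end Literature.Probability.Percolation
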